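import Summits.QuantumFields.BalabanUV.T4Continuum.Support.BalabanAveragedTowerApply
import Summits.QuantumFields.BalabanUV.T4Continuum.Support.BalabanAveragedCoercive
import Literature.MathematicalPhysics.QuantumFieldTheory.Balaban1983to89.B5Composition116
import Literature.MathematicalPhysics.QuantumFieldTheory.Balaban1983to89.B5Blocks16

/-!
# T⁴ programme, spine node NE2 (U1a) — the TRANSPORT between b05's carriers and the tower's carriers, and the
# UNCONDITIONAL η-rate of the inverses `(n^d Q_k𝒢Q_kᴴ)⁻¹` at `U = 1`

Eighth generation of the NE2 prover lineage P1 of the cell `pub-balaban`, file 13.  `Spine/CoerciveInverseTower` reduced the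
η-rate of the inverses of the averaged unit-lattice covariances `c_k = unitCovB k` (the tower built from the one-step
averagings `QB = Qavg ∘ Lavg` on the carriers `Tor (fine 1 M) × Fin d`) to the typed input `UniformCoercive L M a γ`;
`Support/BalabanAveragedCoercive` proved `γ(d,a)`-coercivity of b05's ONE-LEVEL object `covB n hn M a ha = n^d·QvOp 𝒢 QvOpᴴ`
on the carriers `Tor M × Fin d` of the lineage's leaf `B5QGQ171Unit`.  THIS FILE identifies the two objects and closes the
reduction:

* §1 (the digits of a fine site): `w = bpt n M y j ↔ w ∈ B^n(y) ∧ j = digits(w)` (`eq_bpt_iff`), hence the ENTRIES of the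
  printed averaging `QvOp` ([B5] (1.18)) are the contour counts of `Support/BalabanAveragedTowerApply`:
  `QvOp n M (y,μ) (x,ν) = δ_{μν}·n^{−(d+1)}·#{t < n : x − t e_μ ∈ B^n(y)}` (`QvOp_apply_lineCount`).
* §2 (transport): along the canonical identification `unitIdx L M : Tor (fine 1 M) × Fin d ≃ Tor M × Fin d` (componentwise
  `ZMod (1·M_ν) ≃ ZMod M_ν`, `.val`-preserving), the composite of `k` one-step averagings IS the printed `k`-level averaging,
  `Atow QBlev k = (QvOp (L^k) M).submatrix unitIdx id` (`Atow_QBlev_eq_submatrix`, from the semigroup identity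
  `Atow_QBlev_apply` of file 9 and §1), and therefore **`unitCovB k = (covB (L^k) …).submatrix unitIdx unitIdx`**
  (`unitCovB_eq_submatrix`): the tower object of this lineage and b05's (1.71) object coincide up to relabelling.
* §3 (pay-off, all UNCONDITIONAL at `U = 1`): coercivity transports along index equivalences (`coercive_submatrix`), so
  **`uniformCoercive_unitCovB : UniformCoercive L M a (γ(d,a))`** and **`inv_unitCovB_tendsto`**: for `L ≥ 2` the inverses
  `c_k⁻¹` converge, with the limit `γ(d,a)`-coercive and `‖c_k⁻¹ − c_∞⁻¹‖ ≤ γ(d,a)⁻²·CQB(d,a)·L^{−k}/(1 − L^{−1})`; read on b05's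
  FIXED carrier `Tor M × Fin d` (`covBlev k = covB (L^k) …`): **`covBlev_tendsto`** (rate `CQB·L^{−k}/(1 − L^{−1})` for the
  covariances, `γ⁻²·` that for their inverses, coercive limit).

WHAT THIS BUYS (and what it does not).  With files 3, 10, 12 this settles, at `U = 1` on a fixed finite torus, the η-RATE
(convergence with the geometric rate `L^{−k}`, explicit constants) of BOTH the sandwiched objects `n^d Q_k𝒢Q_kᴴ` AND their
inverses — the operators which, by the Woodbury/Schur-complement dictionary of [B5] (1.65)/(1.69) (`Δ_k + a·(…)` versus
`(Q_k𝒢Q_kᴴ)^{−1}`; NOT typed in the tree, residual (R9.xii) of the cell record), carry the δ-function effective actions of node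
U1a.  Nothing here is an estimate at `U ≠ 1`: the background-field carriers `G_k(U)`, `Q_k(U)` are not in the tree (open row
G-an2-4), and the `U ≠ 1` one-step laws remain the typed inputs `OneStepAveragedLaw` / `OneStepInjectedLaw` of files 1 and 8.

HONEST FRAMING (T4-DAG p. 1).  [folklore] finite-dimensional linear algebra and lattice combinatorics about the cell's own
objects and the printed (1.18)/(1.71) at `U = 1`; statements OURS; no printed sentence is used as a hypothesis.  `U = 1`, FIXED
FINITE torus, linear layer; NOT `U ≠ 1` (WALL G-an2-4), NOT infinite volume, NOT a mass gap, NOT Clay, NOT summit progress.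
HONEST DEPENDENCY: continuum YM on T⁴ ⇐ BetaPertH ∧ nine spine estimates (0/9 proved); BetaPertH ⇐ (D1) ∧ (D4) ∧ CAP+tail;
G-an2-4 gates asym, D1 and NE2/3/4.  ABSOLUTE RULE kept; no `sorry`.
-/

noncomputable section

open scoped BigOperators ComplexConjugate Matrix Matrix.Norms.L2Operator Topology
open Finset Filter

namespace Summit.QuantumFields.BalabanUV.T4Continuum.BalabanAveragedCoerciveTower

open Literature.MathematicalPhysics.QuantumFieldTheory.Balaban1983to89.B5Prop11Plancherel
open Literature.MathematicalPhysics.QuantumFieldTheory.Balaban1983to89.B5Prop11Lower (nsq nsq_nonneg)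
open Literature.MathematicalPhysics.QuantumFieldTheory.Balaban1983to89.B5Block118 (tstep bpt QvOp)
open Literature.MathematicalPhysics.QuantumFieldTheory.Balaban1983to89.B5Blocks16 (bpt_val)
open Literature.MathematicalPhysics.QuantumFieldTheory.Balaban1983to89.B5Composition116 (recast recast_apply)
open Literature.MathematicalPhysics.QuantumFieldTheory.Balaban1983to89.B5QGQ171Unit (covB)
open Literature.MathematicalPhysics.QuantumFieldTheory.Balaban1983to89.B5G183RateUnitTower (lev lev_neZero)
open Summit.QuantumFields.BalabanUV.T4Continuum.CovariantAveragingTower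
open Summit.QuantumFields.BalabanUV.T4Continuum.BalabanLineAverage
open Summit.QuantumFields.BalabanUV.T4Continuum.BalabanAveragedTowerUnit
open Summit.QuantumFields.BalabanUV.T4Continuum.BalabanAveragedTowerApply
open Summit.QuantumFields.BalabanUV.T4Continuum.CoerciveInverseTower
open Summit.QuantumFields.BalabanUV.T4Continuum.BalabanAveragedCoercive (gammaB gammaB_pos coercive_covB')

variable {d : ℕ}

/-! ## §1 The digits of a fine site and the entries of the printed averaging `QvOp` -/

section Digits

variable (n : ℕ) [NeZero n] (M : Fin d → ℕ) [hM : ∀ μ, NeZero (M μ)]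

omit hM in
/-- the offset digits `j_ν = v(w_ν) mod n ∈ {0,…,n−1}` of a fine site `w ∈ T_η`. [folklore] -/
def jdig (w : Tor (fine n M)) : Fin d → Fin n :=
  fun ν => ⟨(w ν).val % n, Nat.mod_lt _ (Nat.pos_of_ne_zero (NeZero.ne n))⟩

/-- the block decomposition of a fine site read off its digits: `w = n·y + j` iff `w ∈ B^n(y)` (`⌊v(w_ν)/n⌋ = v(y_ν)`) and
`j` is the vector of remainders `v(w_ν) mod n`. [cite: Balaban1984PropagatorsI, (1.6) p.18] -/
theorem eq_bpt_iff (y : Tor M) (j : Fin d → Fin n) (w : Tor (fine n M)) :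
    w = bpt n M y j ↔ InBlock M n (fun ν => (y ν).val) w ∧ j = jdig n M w := by
  have hn : 0 < n := Nat.pos_of_ne_zero (NeZero.ne n)
  constructor
  · rintro rfl
    refine ⟨fun ν => ?_, funext fun ν => Fin.ext ?_⟩
    · rw [bpt_val, Nat.mul_add_div hn, Nat.div_eq_of_lt (j ν).is_lt, add_zero]
    · show (j ν : ℕ) = (bpt n M y j ν).val % n
      rw [bpt_val, Nat.mul_add_mod, Nat.mod_eq_of_lt (j ν).is_lt]
  · rintro ⟨hb, rfl⟩
    funext ν
    refine ZMod.val_injective _ ?_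
    rw [bpt_val]
    have hbν : (w ν).val / n = (y ν).val := hb ν
    show (w ν).val = n * (y ν).val + (w ν).val % n
    rw [← hbν, Nat.div_add_mod]

/-- summing the indicator of `w = n·y + j` over the offsets `j` gives the indicator of the block: `Σ_j [w = n·y + j] =
[w ∈ B^n(y)]`. [folklore] -/
theorem sum_ite_eq_bpt (y : Tor M) (w : Tor (fine n M)) :
    (∑ j : Fin d → Fin n, if w = bpt n M y j then (1 : ℂ) else 0)
      = if InBlock M n (fun ν => (y ν).val) w then 1 else 0 := by
  simp_rw [eq_bpt_iff n M y _ w]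
  by_cases hb : InBlock M n (fun ν => (y ν).val) w
  · simp only [hb, true_and, if_true, Finset.sum_ite_eq', Finset.mem_univ]
  · simp [hb]

/-- **the entries of the printed averaging are contour counts**: `QvOp n M (y,μ) (x,ν) = δ_{μν}·n^{−(d+1)}·#{t < n :
x − t e_μ ∈ B^n(y)}` — (1.18) «(Q_kA)_b = Σ_{x∈B^k(b₋)} η^{d+1}A([x, x(b)])» read entrywise: the fine bond `⟨x, x + ηe_ν⟩`
receives the weight `η^{d+1}` once for every block point `x − tηe_μ ∈ B^k(y)`, `0 ≤ t < n`, whose straight contour towards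
`+e_μ` passes through it. [cite: Balaban1984PropagatorsI, (1.18) p.20] -/
theorem QvOp_apply_lineCount (b : Tor M × Fin d) (i : Tor (fine n M) × Fin d) :
    QvOp n M b i
      = if b.2 = i.2 then (((n : ℂ)) ^ (d + 1))⁻¹ * lineCount M n (fun ν => (b.1 ν).val) b.2 i.1 else 0 := by
  obtain ⟨y, μ⟩ := b
  obtain ⟨x, ν⟩ := i
  simp only [QvOp]
  by_cases h : μ = ν
  · subst h
    rw [if_pos rfl, if_pos rfl, lineCount, Finset.mul_sum, Finset.sum_comm]
    refine Finset.sum_congr rfl fun t _ => ?_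
    have e : ∀ j : Fin d → Fin n,
        (x = bpt n M y j + tstep (fine n M) μ (t : ℕ)) ↔ (x - tstep (fine n M) μ (t : ℕ) = bpt n M y j) :=
      fun j => by rw [sub_eq_iff_eq_add]
    simp_rw [e]
    rw [← sum_ite_eq_bpt n M y (x - tstep (fine n M) μ t), Finset.mul_sum]
    refine Finset.sum_congr rfl fun j _ => ?_
    split_ifs <;> simp [one_div]
  · rw [if_neg (fun e => h e.symm), if_neg h]

end Digits

/-! ## §2 The transport: the tower's composite averaging IS the printed `k`-level averaging, relabelled -/

section Transport

variable (L : ℕ) [NeZero L] (M : Fin d → ℕ) [hM : ∀ μ, NeZero (M μ)]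

/-- the canonical identification of the unit lattice written with moduli `1·M_ν` (the tower's level `0`, `Tor (fine 1 M)`) and
with moduli `M_ν` (b05's `Tor M`): componentwise `ZMod.ringEquivCongr (one_mul _)`. [folklore] -/
def unitSites : Tor (fine 1 M) ≃ Tor M := recast (fun ν => one_mul (M ν))

omit hM in
/-- `unitSites` preserves the integer coordinates. [folklore] -/
theorem val_unitSites (x : Tor (fine 1 M)) (ν : Fin d) : (unitSites M x ν).val = (x ν).val := by
  rw [unitSites, recast_apply, ZMod.ringEquivCongr_val]

/-- the same identification on vector-field indices (sites × directions), typed on the tower's level-`0` index set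
`idx L M 0 = Tor (fine (lev L 0) M) × Fin d` (`lev L 0 = 1` definitionally). [folklore] -/
def unitIdx : idx L M 0 ≃ Tor M × Fin d := Equiv.prodCongr (unitSites M) (Equiv.refl (Fin d))

omit [NeZero L] hM in
/-- `unitIdx (x, μ) = (unitSites x, μ)`. [folklore] -/
@[simp] theorem unitIdx_apply (i : idx L M 0) : unitIdx L M i = (unitSites M i.1, i.2) := rfl

omit [NeZero L] in
/-- `n_k = L^k` in `ℂ`. [folklore] -/
theorem natCast_lev (k : ℕ) : ((lev L k : ℕ) : ℂ) = (L : ℂ) ^ k := by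
  have h := cast_lev' L k
  have h' : (((lev L k : ℕ) : ℝ) : ℂ) = (((L : ℝ) ^ k : ℝ) : ℂ) := by rw [h]
  push_cast at h'
  exact h'

/-- **THE COMPOSITE OF THE ONE-STEP AVERAGINGS IS THE PRINTED `k`-LEVEL AVERAGING**: `QB_{n_0} ⋯ QB_{n_{k−1}} = Q_k` of (1.18)
with `L` replaced by `L^k`, up to the relabelling `unitIdx` of the unit lattice (entrywise: both are the contour counts,
`Atow_QBlev_apply` and `QvOp_apply_lineCount`). [cite: Balaban1984PropagatorsI, (1.18) p.20] -/
theorem Atow_QBlev_eq_submatrix (k : ℕ) :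
    Atow (QBlev L M) k = (QvOp (lev L k) M).submatrix (unitIdx L M) id := by
  ext i y
  rw [Matrix.submatrix_apply, Atow_QBlev_apply, QvOp_apply_lineCount]
  simp only [unitIdx_apply, id, val_unitSites]
  rfl

variable (a : ℝ) (ha : 0 < a)

/-- **THE TOWER OBJECT IS b05's (1.71) OBJECT, RELABELLED**: `unitCovB k = (L^d)^k·Atow_k 𝒢^{(L^{−k})} Atow_kᴴ` equals
`covB (L^k) = (L^k)^d·Q_k 𝒢^{(L^{−k})} Q_kᴴ` read through `unitIdx` on both indices. [cite: Balaban1984PropagatorsI, (1.71) p.30] -/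
theorem unitCovB_eq_submatrix (k : ℕ) :
    unitCovB L M a ha k = (covB (lev L k) (one_le_lev' L k) M a ha).submatrix (unitIdx L M) (unitIdx L M) := by
  rw [unitCovB, avgTow, calGlev, covB, Matrix.submatrix_smul, Pi.smul_apply, Pi.smul_apply,
    Matrix.submatrix_mul _ _ (unitIdx L M) id (unitIdx L M) Function.bijective_id,
    Matrix.submatrix_mul _ _ (unitIdx L M) id id Function.bijective_id, Matrix.submatrix_id_id,
    ← Matrix.conjTranspose_submatrix, ← Atow_QBlev_eq_submatrix]
  congr 1
  rw [natCast_lev]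
  push_cast
  ring

/-- b05's averaged propagators ALONG THE LEVELS `n_k = L^k`, on the FIXED carrier `Tor M × Fin d`:
`covBlev k = (L^k)^d·Q_k 𝒢^{(L^{−k})} Q_kᴴ` ((1.71) at `U = 1`). [cite: Balaban1984PropagatorsI, (1.71) p.30] -/
def covBlev (k : ℕ) : Matrix (Tor M × Fin d) (Tor M × Fin d) ℂ := covB (lev L k) (one_le_lev' L k) M a ha

/-- `covBlev k` is `unitCovB k` relabelled back. [folklore] -/
theorem covBlev_eq_submatrix (k : ℕ) :
    covBlev L M a ha k = (unitCovB L M a ha k).submatrix (unitIdx L M).symm (unitIdx L M).symm := by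
  rw [unitCovB_eq_submatrix, Matrix.submatrix_submatrix, Equiv.self_comp_symm, Matrix.submatrix_id_id, covBlev]

end Transport

/-! ## §3 Pay-off: uniform coercivity of the tower and the UNCONDITIONAL rate for the inverses at `U = 1` -/

section Payoff

/-- relabelling both indices along an equivalence preserves the operator norm. [folklore] -/
theorem opNorm_submatrix_equiv {ι κ : Type*} [Fintype ι] [Fintype κ] [DecidableEq ι] [DecidableEq κ]
    (A : Matrix κ κ ℂ) (e : ι ≃ κ) : ‖A.submatrix e e‖ = ‖A‖ := by
  have h := opNorm_reindex e.symm A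
  rwa [Matrix.reindex_apply, Equiv.symm_symm] at h

/-- relabelling commutes with differences (pointwise form of `Matrix.submatrix_sub`). [folklore] -/
theorem submatrix_sub_eq {ι κ : Type*} (A B : Matrix κ κ ℂ) (e : ι → κ) :
    (A - B).submatrix e e = A.submatrix e e - B.submatrix e e := rfl

/-- coercivity transports along index equivalences: `⟨x, A∘(e×e) x⟩ = ⟨x∘e⁻¹, A (x∘e⁻¹)⟩`, `‖x‖ = ‖x∘e⁻¹‖`. [folklore] -/
theorem coercive_submatrix {ι κ : Type*} [Fintype ι] [Fintype κ] [DecidableEq ι] [DecidableEq κ] {γ : ℝ}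
    {A : Matrix κ κ ℂ} (h : Coercive γ A) (e : ι ≃ κ) : Coercive γ (A.submatrix e e) := by
  intro x
  have h1 : A.submatrix e e *ᵥ x = (A *ᵥ (x ∘ e.symm)) ∘ e := Matrix.submatrix_mulVec_equiv A x e e
  have h2 : nsq x = nsq (x ∘ e.symm) := by
    unfold nsq
    exact (e.symm.sum_comp (fun j => ‖x j‖ ^ 2)).symm
  have h3 : star x ⬝ᵥ ((A *ᵥ (x ∘ e.symm)) ∘ e) = star (x ∘ e.symm) ⬝ᵥ (A *ᵥ (x ∘ e.symm)) := by
    have hs : star x = star (x ∘ ⇑e.symm) ∘ ⇑e := by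
      funext i
      simp
    rw [hs, BalabanAveragedCoerciveFibre.dotProduct_comp_equiv]
  rw [h1, h3, h2]
  exact h (x ∘ e.symm)

variable (L : ℕ) [NeZero L] (M : Fin d → ℕ) [hM : ∀ μ, NeZero (M μ)] (a : ℝ) (ha : 0 < a)

/-- **UNIFORM COERCIVITY OF THE TOWER** (the typed input of `Spine/CoerciveInverseTower`, DISCHARGED at `U = 1`): every
`unitCovB k` is `γ(d,a)`-coercive, `γ(d,a) = ((dπ² + a)(π²/4)^{d+1})⁻¹`. [folklore] -/
theorem uniformCoercive_unitCovB : UniformCoercive L M a ha (gammaB d a) := fun k => by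
  rw [unitCovB_eq_submatrix]
  exact coercive_submatrix (coercive_covB' (lev L k) (one_le_lev' L k) M a ha) (unitIdx L M)

/-- **THE η-RATE OF THE INVERSES AT `U = 1`, UNCONDITIONAL** (`L ≥ 2`): the averaged unit-lattice covariances `c_k` converge,
the limit is `γ(d,a)`-coercive (so invertible), the inverses `c_k⁻¹` converge to `c_∞⁻¹`, and
`‖c_k⁻¹ − c_∞⁻¹‖ ≤ γ(d,a)⁻²·CQB(d,a)·L^{−k}/(1 − L^{−1})`. [folklore] -/
theorem inv_unitCovB_tendsto (hL : 2 ≤ L) :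
    ∃ cinf : Matrix (idx L M 0) (idx L M 0) ℂ,
      Tendsto (unitCovB L M a ha) atTop (𝓝 cinf) ∧ Coercive (gammaB d a) cinf ∧
      Tendsto (fun k => (unitCovB L M a ha k)⁻¹) atTop (𝓝 cinf⁻¹) ∧
      ∀ k, ‖(unitCovB L M a ha k)⁻¹ - cinf⁻¹‖
        ≤ ((gammaB d a)⁻¹) ^ 2 * (CQB d a * ((L : ℝ)⁻¹) ^ k / (1 - (L : ℝ)⁻¹)) :=
  inv_unitCovB_tendsto_of_uniformCoercive L M a ha hL (gammaB_pos a ha) (uniformCoercive_unitCovB L M a ha)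

/-- the one-step differences read on b05's carrier: `‖covBlev (k+1) − covBlev k‖ ≤ CQB(d,a)·L^{−k}`. [folklore] -/
theorem opNorm_covBlev_succ_sub_le (k : ℕ) :
    ‖covBlev L M a ha (k + 1) - covBlev L M a ha k‖ ≤ CQB d a * ((L : ℝ)⁻¹) ^ k := by
  rw [covBlev_eq_submatrix, covBlev_eq_submatrix, ← submatrix_sub_eq, opNorm_submatrix_equiv]
  exact opNorm_unitCovB_succ_sub_le L M a ha k

/-- **THE η-RATE ON b05's FIXED CARRIER `Tor M × Fin d`** (`L ≥ 2`): the averaged propagators `covBlev k = (L^k)^d·Q_k𝒢Q_kᴴ`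
((1.71) at `U = 1`, levels `L^k`) converge with `‖covBlev k − c_∞‖ ≤ CQB(d,a)·L^{−k}/(1 − L^{−1})`, the limit is
`γ(d,a)`-coercive, and their inverses converge with `‖(covBlev k)⁻¹ − c_∞⁻¹‖ ≤ γ(d,a)⁻²·CQB(d,a)·L^{−k}/(1 − L^{−1})`.
[folklore] -/
theorem covBlev_tendsto (hL : 2 ≤ L) :
    ∃ cinf : Matrix (Tor M × Fin d) (Tor M × Fin d) ℂ,
      Tendsto (covBlev L M a ha) atTop (𝓝 cinf) ∧
      (∀ k, ‖covBlev L M a ha k - cinf‖ ≤ CQB d a * ((L : ℝ)⁻¹) ^ k / (1 - (L : ℝ)⁻¹)) ∧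
      Coercive (gammaB d a) cinf ∧
      Tendsto (fun k => (covBlev L M a ha k)⁻¹) atTop (𝓝 cinf⁻¹) ∧
      ∀ k, ‖(covBlev L M a ha k)⁻¹ - cinf⁻¹‖
        ≤ ((gammaB d a)⁻¹) ^ 2 * (CQB d a * ((L : ℝ)⁻¹) ^ k / (1 - (L : ℝ)⁻¹)) := by
  obtain ⟨c', -, hrate'⟩ := unitCovB_tendsto L M a ha hL
  set cinf : Matrix (Tor M × Fin d) (Tor M × Fin d) ℂ := c'.submatrix (unitIdx L M).symm (unitIdx L M).symm with hcinf
  have hrate : ∀ k, ‖covBlev L M a ha k - cinf‖ ≤ CQB d a * ((L : ℝ)⁻¹) ^ k / (1 - (L : ℝ)⁻¹) := fun k => by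
    rw [hcinf, covBlev_eq_submatrix, ← submatrix_sub_eq, opNorm_submatrix_equiv]
    exact hrate' k
  have hL1 : (1 : ℝ) < L := by exact_mod_cast (lt_of_lt_of_le one_lt_two hL : 1 < L)
  have hρ0 : (0 : ℝ) ≤ (L : ℝ)⁻¹ := inv_nonneg.mpr (Nat.cast_nonneg _)
  have hρ1 : (L : ℝ)⁻¹ < 1 := inv_lt_one_of_one_lt₀ hL1
  have hlim : Tendsto (covBlev L M a ha) atTop (𝓝 cinf) := by
    rw [tendsto_iff_norm_sub_tendsto_zero]
    refine squeeze_zero (fun k => norm_nonneg _) hrate ?_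
    have h1 : Tendsto (fun k => ((L : ℝ)⁻¹) ^ k) atTop (𝓝 0) := tendsto_pow_atTop_nhds_zero_of_lt_one hρ0 hρ1
    simpa using (h1.const_mul (CQB d a)).div_const (1 - (L : ℝ)⁻¹)
  obtain ⟨hco, hti, hb⟩ := inverse_tower_of_coercive (gammaB_pos a ha)
    (fun k => coercive_covB' (lev L k) (one_le_lev' L k) M a ha) hlim hρ0 hρ1 hrate
  exact ⟨cinf, hlim, hrate, hco, hti, hb⟩

end Payoff

end Summit.QuantumFields.BalabanUV.T4Continuum.BalabanAveragedCoerciveTower
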